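import Summits.Parity.GeneralizedHardyLittlewood.Theorems.PrimeLevelFamEdgeMomentsBeyondDiagonalDiagLTerm
import Mathlib.Data.Nat.Factorization.Basic
import HarnessLib

/-!
# Route `PrimeLevelFamEdge`, crux K_A `MomentsBeyondDiagonal` (stmt-Parity-20007), line «petersson_layers» v4, stub `stub_diag`:
# **the BILINEAR HARMONIC ASSEMBLY: `Σ_{n≤M} φ(n)W(n)²·S₁(n)S₂(n) = ζ(2)²·(∫₀¹R₁R₂)·log M/log^{s₁+s₂}M + O(log^{−(s₁+s₂)}M)`
# for any two profile-coordinate-like families `S_i(n) = E_n·R_i(u_n)/log^{s_i}M + O(D(n)(1+κ(n))/log^{s_i+1}M)`**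

Census R3(ii), ANALYTIC HALF: the generic `n`-sum step of every per-order target of `…DiagOrderSelberg`. After the
decorated `k`-sums are evaluated by the (decorated) profile coordinates (`…DiagProfileCoord`: `E_n P″(u_n)/log²M`;
`…DiagDecorProfileCoord`: `E_n P(u_n)`, `−E_n P′(u_n)/log M`, …) and the `(c,g) ↦ n` collapse (`…DiagDecorCollapse`,
weight `φ(n)` for the `log g`-free monomials), each main monomial is a bilinear `n`-sum `Σ_n φ(n)W(n)² S₁(n)S₂(n)`. With
`φ(n)W(n)²E_n = ζ(2)|W(n)|` (`KernelFormXSqCollapse.totient_mul_W_sq_mul_mainConst`) and the polynomial-weight harmonic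
engine `Σ_{n≤M}|W(n)|E_n R(u_n) = ζ(2)log M∫₀¹R + O_R(1)` (`…DiagPolyWeight`) — the template of `…DiagLTerm`/`…DiagPTerm`
made generic:

* `kappa_le_log` — `κ(n) ≤ log n` (`n ≥ 1`);
* `abs_bilinearHarmonic_sub_le` — **for real polynomials `R₁, R₂`, exponents `s₁, s₂` and families `S₁ S₂ : ℝ → ℕ → ℝ` with
  `|S_i M n − E_n R_i(u_n)/log^{s_i}M| ≤ C_i·D(n)(1+κ(n))/log^{s_i+1}M` (`M ≥ 3`, `1 ≤ n ≤ M`):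
  `|Σ_{n≤M} φ(n)W(n)² S₁ M n·S₂ M n − (π²/6)²·(∫₀¹R₁R₂)·log M/log^{s₁+s₂}M| ≤ C/log^{s₁+s₂}M`**
  (errors through `E_n ≤ C_E D(n)`, `φW² ≤ 1/n`, `Σ D²/n`, `Σ κD²/n ≪ log M` of `KernelFormXSqSums/B`, `κ ≤ log n ≤ log M`).

E.g. `(S₁,S₂) = (τ_{1,1}, τ_{1,1})`-coordinates (`s = 0`): `ζ(2)²∫₀¹P²·log M`; `(P″-coordinate, τ_{1,1})` (`s = 2, 0`):
`ζ(2)²∫₀¹P″P/log M`; these are the `n`-sums of the order-`(1,1)` target. Def-free; theorems only. Helper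
`--supports stmt-Parity-20007`; closes nothing; K_A, K_B and the Parity summit are NOT proved; nothing about Landau–Siegel zeros.

## References
* E. Kowalski, P. Michel, J. VanderKam, J. reine angew. Math. 526 (2000), Prop. 5.1 (31) p. 18 (the integrals `∫₀¹` of
  the main terms as limits of the `n`-sums). [cite: KowalskiMichelVanderKam2000, Prop. 5.1 — derivation (bilinear n-sums)]
-/

noncomputable section

open scoped Real ArithmeticFunction.Moebius
open Finset ArithmeticFunction Polynomial MeasureTheory intervalIntegral

namespace Summit.Parity.GeneralizedHardyLittlewood.Theorems.MomentsBeyondDiagonal.DiagKernel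

open Literature.NumberTheory.LFunctions Literature.NumberTheory.LFunctions.KMV2000
open MollifierMainTerm (W)
open SelbergCoord (kappa)
open Literature.NumberTheory.Sieve (one_le_log_of_three_le)
open Summit.Parity.GeneralizedHardyLittlewood.Theorems.BeyondDiagonalBeatsQuarter.KernelFormXSq
  (mainConst divWeight divWeight_nonneg mainConst_nonneg mainConst_le_divWeight
    totient_mul_W_sq_mul_mainConst totient_mul_W_sq_le sum_divWeight_sq_div_le sum_kappa_divWeight_sq_div_le)

/-! ### Small facts -/

/-- `κ(n) ≤ log n` (`n ≥ 1`): `log p/(p−1) ≤ log p` and `Σ_{p∣n}log p = log rad(n) ≤ log n`. [folklore] -/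
theorem kappa_le_log {n : ℕ} (hn : n ≠ 0) : kappa n ≤ Real.log n := by
  unfold kappa
  have h1 : ∑ p ∈ n.primeFactors, Real.log p / ((p : ℝ) - 1) ≤ ∑ p ∈ n.primeFactors, Real.log p := by
    refine Finset.sum_le_sum fun p hp ↦ ?_
    have hp2 : (2 : ℝ) ≤ p := by exact_mod_cast (Nat.prime_of_mem_primeFactors hp).two_le
    have hlp : 0 ≤ Real.log p := Real.log_nonneg (by linarith)
    rw [div_le_iff₀ (by linarith)]
    nlinarith
  refine h1.trans ?_
  have hprod : ∑ p ∈ n.primeFactors, Real.log p = Real.log ((∏ p ∈ n.primeFactors, p : ℕ) : ℝ) := by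
    push_cast
    rw [Real.log_prod]
    intro p hp
    exact_mod_cast (Nat.prime_of_mem_primeFactors hp).ne_zero
  rw [hprod]
  have hdvd := Nat.prod_primeFactors_dvd n
  have hpos : 0 < ∏ p ∈ n.primeFactors, p := Finset.prod_pos fun p hp ↦ (Nat.prime_of_mem_primeFactors hp).pos
  exact Real.log_le_log (by exact_mod_cast hpos) (by exact_mod_cast Nat.le_of_dvd (Nat.pos_of_ne_zero hn) hdvd)

/-! ### The bilinear harmonic assembly -/

set_option maxHeartbeats 400000 in
/-- **The bilinear harmonic assembly.** Let `R₁, R₂` be real polynomials, `s₁, s₂ : ℕ`, and `S₁ S₂ : ℝ → ℕ → ℝ` with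
`|S_i M n − E_n·R_i(log(M/n)/log M)/log^{s_i}M| ≤ C_i·D(n)(1+κ(n))/log^{s_i+1}M` for `M ≥ 3`, `1 ≤ n ≤ M`. Then there is `C`
with, for all `M ≥ 3`,
`|Σ_{n≤M} φ(n)W(n)²·S₁ M n·S₂ M n − (π²/6)²·(∫₀¹R₁R₂)·log M/log^{s₁+s₂}M| ≤ C/log^{s₁+s₂}M`.
[cite: KowalskiMichelVanderKam2000, Prop. 5.1 — derivation (bilinear n-sums of the diagonal main term)] -/
theorem abs_bilinearHarmonic_sub_le (R₁ R₂ : ℝ[X]) (s₁ s₂ : ℕ) (S₁ S₂ : ℝ → ℕ → ℝ) {C₁ C₂ : ℝ} (hC₁ : 0 ≤ C₁) (hC₂ : 0 ≤ C₂)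
    (h₁ : ∀ M : ℝ, 3 ≤ M → ∀ n : ℕ, n ≠ 0 → (n : ℝ) ≤ M →
      |S₁ M n - mainConst n * R₁.eval (Real.log (M / n) / Real.log M) / Real.log M ^ s₁| ≤
        C₁ * divWeight n * (1 + kappa n) / Real.log M ^ (s₁ + 1))
    (h₂ : ∀ M : ℝ, 3 ≤ M → ∀ n : ℕ, n ≠ 0 → (n : ℝ) ≤ M →
      |S₂ M n - mainConst n * R₂.eval (Real.log (M / n) / Real.log M) / Real.log M ^ s₂| ≤
        C₂ * divWeight n * (1 + kappa n) / Real.log M ^ (s₂ + 1)) :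
    ∃ C : ℝ, 0 < C ∧ ∀ M : ℝ, 3 ≤ M →
      |∑ n ∈ Icc 1 ⌊M⌋₊, (Nat.totient n : ℝ) * W n ^ 2 * (S₁ M n * S₂ M n) -
          (π ^ 2 / 6) ^ 2 * (∫ u in (0 : ℝ)..1, (R₁ * R₂).eval u) * Real.log M / Real.log M ^ (s₁ + s₂)| ≤
        C / Real.log M ^ (s₁ + s₂) := by
  -- `|R(u)| ≤ Σ|R_i|` on `[0,1]` (the tree's `Literature.NumberTheory.LFunctions.abs_eval_le_sum_abs_coeff`, inlined)
  have abs_eval_le : ∀ (R : ℝ[X]) {u : ℝ}, 0 ≤ u → u ≤ 1 →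
      |R.eval u| ≤ ∑ i ∈ Finset.range (R.natDegree + 1), |R.coeff i| := by
    intro R u hu0 hu1
    rw [Polynomial.eval_eq_sum_range]
    refine (Finset.abs_sum_le_sum_abs _ _).trans (Finset.sum_le_sum fun i _ ↦ ?_)
    rw [abs_mul, abs_pow, abs_of_nonneg hu0]
    exact mul_le_of_le_one_right (abs_nonneg _) (pow_le_one₀ hu0 hu1)
  obtain ⟨C_R, hC_R, hR⟩ := abs_sum_absW_mainConst_mul_eval_sub_integral_le (R₁ * R₂)
  obtain ⟨C_E, hC_E, hE⟩ := mainConst_le_divWeight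
  set B₁ : ℝ := ∑ i ∈ Finset.range (R₁.natDegree + 1), |R₁.coeff i| with hB₁
  set B₂ : ℝ := ∑ i ∈ Finset.range (R₂.natDegree + 1), |R₂.coeff i| with hB₂
  have hB₁0 : 0 ≤ B₁ := Finset.sum_nonneg fun i _ ↦ abs_nonneg _
  have hB₂0 : 0 ≤ B₂ := Finset.sum_nonneg fun i _ ↦ abs_nonneg _
  set A : ℝ := (∑' d : ℕ, (d : ℝ) ^ (-(5 / 4 : ℝ))) ^ 2 with hA
  have hA0 : 0 ≤ A := by positivity
  -- the constant
  set K : ℝ := (C_E * B₁ * C₂ + C₁ * C_E * B₂ + 2 * C₁ * C₂) * (49 * A * 3) with hK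
  have hK0 : 0 ≤ K := by positivity
  refine ⟨π ^ 2 / 6 * C_R + K + 1, by positivity, fun M hM ↦ ?_⟩
  set ℓ := Real.log M with hℓ
  have hℓ1 : 1 ≤ ℓ := one_le_log_of_three_le hM
  have hℓ0 : 0 < ℓ := by linarith
  have hM0 : 0 < M := by linarith
  set N := ⌊M⌋₊ with hN
  have hN1 : 1 ≤ N := Nat.le_floor (by norm_num; linarith)
  have hlogN : Real.log N ≤ ℓ := Real.log_le_log (by exact_mod_cast hN1) (Nat.floor_le hM0.le)
  -- abbreviations for the main parts
  set m₁ : ℕ → ℝ := fun n ↦ mainConst n * R₁.eval (Real.log (M / n) / ℓ) / ℓ ^ s₁ with hm₁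
  set m₂ : ℕ → ℝ := fun n ↦ mainConst n * R₂.eval (Real.log (M / n) / ℓ) / ℓ ^ s₂ with hm₂
  -- range facts
  have hrange : ∀ n ∈ Icc 1 N, n ≠ 0 ∧ (n : ℝ) ≤ M ∧ 0 ≤ Real.log (M / n) / ℓ ∧ Real.log (M / n) / ℓ ≤ 1 := by
    intro n hn
    have hn' := Finset.mem_Icc.1 hn
    have hn0 : n ≠ 0 := by omega
    have hnM : (n : ℝ) ≤ M := le_trans (by exact_mod_cast hn'.2) (Nat.floor_le hM0.le)
    obtain ⟨hy0, hyℓ⟩ := log_div_nonneg_and_le hM hn0 hnM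
    exact ⟨hn0, hnM, div_nonneg hy0 hℓ0.le, (div_le_one hℓ0).2 hyℓ⟩
  -- Step 1: the main part `Σ φW² m₁m₂ = (π²/6)/ℓ^{s₁+s₂}·Σ|W|E(R₁R₂)(u_n)`
  have hmain_eq : ∑ n ∈ Icc 1 N, (Nat.totient n : ℝ) * W n ^ 2 * (m₁ n * m₂ n) =
      π ^ 2 / 6 / ℓ ^ (s₁ + s₂) * ∑ n ∈ Icc 1 N, |W n| * mainConst n * (R₁ * R₂).eval (Real.log (M / n) / ℓ) := by
    rw [Finset.mul_sum]
    refine Finset.sum_congr rfl fun n hn ↦ ?_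
    obtain ⟨hn0, -⟩ := hrange n hn
    have hid := totient_mul_W_sq_mul_mainConst hn0
    simp only [hm₁, hm₂, Polynomial.eval_mul]
    rw [pow_add]
    have : (Nat.totient n : ℝ) * W n ^ 2 * (mainConst n * R₁.eval (Real.log (M / n) / ℓ) / ℓ ^ s₁ *
        (mainConst n * R₂.eval (Real.log (M / n) / ℓ) / ℓ ^ s₂)) =
        ((Nat.totient n : ℝ) * W n ^ 2 * mainConst n) * mainConst n *
          (R₁.eval (Real.log (M / n) / ℓ) * R₂.eval (Real.log (M / n) / ℓ)) / (ℓ ^ s₁ * ℓ ^ s₂) := by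
      field_simp
    rw [this, hid]
    field_simp
  have hmain : |∑ n ∈ Icc 1 N, (Nat.totient n : ℝ) * W n ^ 2 * (m₁ n * m₂ n) -
      (π ^ 2 / 6) ^ 2 * (∫ u in (0 : ℝ)..1, (R₁ * R₂).eval u) * ℓ / ℓ ^ (s₁ + s₂)| ≤
      π ^ 2 / 6 * C_R / ℓ ^ (s₁ + s₂) := by
    rw [hmain_eq]
    have e : (π ^ 2 / 6) ^ 2 * (∫ u in (0 : ℝ)..1, (R₁ * R₂).eval u) * ℓ / ℓ ^ (s₁ + s₂) =
        π ^ 2 / 6 / ℓ ^ (s₁ + s₂) * (π ^ 2 / 6 * ℓ * ∫ u in (0 : ℝ)..1, (R₁ * R₂).eval u) := by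
      field_simp
    rw [e, ← mul_sub, abs_mul, abs_of_pos (by positivity : (0 : ℝ) < π ^ 2 / 6 / ℓ ^ (s₁ + s₂))]
    calc π ^ 2 / 6 / ℓ ^ (s₁ + s₂) * |∑ n ∈ Icc 1 N, |W n| * mainConst n * (R₁ * R₂).eval (Real.log (M / n) / ℓ) -
          π ^ 2 / 6 * ℓ * ∫ u in (0 : ℝ)..1, (R₁ * R₂).eval u|
        ≤ π ^ 2 / 6 / ℓ ^ (s₁ + s₂) * C_R := mul_le_mul_of_nonneg_left (hR M hM) (by positivity)
      _ = π ^ 2 / 6 * C_R / ℓ ^ (s₁ + s₂) := by ring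
  -- Step 2: termwise error bound
  have herr : ∀ n ∈ Icc 1 N, |(Nat.totient n : ℝ) * W n ^ 2 * (S₁ M n * S₂ M n) -
      (Nat.totient n : ℝ) * W n ^ 2 * (m₁ n * m₂ n)| ≤
      (n : ℝ)⁻¹ * ((C_E * B₁ * C₂ + C₁ * C_E * B₂ + 2 * C₁ * C₂) * (divWeight n ^ 2 * (1 + kappa n)) /
        ℓ ^ (s₁ + s₂ + 1)) := by
    intro n hn
    obtain ⟨hn0, hnM, hu0, hu1⟩ := hrange n hn
    have hD := divWeight_nonneg n
    have hE0 := mainConst_nonneg n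
    have hEn := hE n hn0
    have hκ : 0 ≤ kappa n := by
      unfold kappa
      exact Finset.sum_nonneg fun p hp ↦ by
        have hp2 : (2 : ℝ) ≤ p := by exact_mod_cast (Nat.prime_of_mem_primeFactors hp).two_le
        exact div_nonneg (Real.log_nonneg (by linarith)) (by linarith)
    have hκℓ : kappa n ≤ ℓ := by
      refine (kappa_le_log hn0).trans ?_
      exact Real.log_le_log (by exact_mod_cast Nat.pos_of_ne_zero hn0) hnM
    have hφW := totient_mul_W_sq_le n
    have hφW0 : 0 ≤ (Nat.totient n : ℝ) * W n ^ 2 := by positivity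
    have hn0' : (0 : ℝ) < n := by exact_mod_cast Nat.pos_of_ne_zero hn0
    set e₁ := S₁ M n - m₁ n with he₁
    set e₂ := S₂ M n - m₂ n with he₂
    have he₁b : |e₁| ≤ C₁ * divWeight n * (1 + kappa n) / ℓ ^ (s₁ + 1) := h₁ M hM n hn0 hnM
    have he₂b : |e₂| ≤ C₂ * divWeight n * (1 + kappa n) / ℓ ^ (s₂ + 1) := h₂ M hM n hn0 hnM
    have hm₁b : |m₁ n| ≤ C_E * divWeight n * B₁ / ℓ ^ s₁ := by
      simp only [hm₁]
      rw [abs_div, abs_mul, abs_of_nonneg hE0, abs_of_pos (pow_pos hℓ0 _)]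
      gcongr
      exact abs_eval_le R₁ hu0 hu1
    have hm₂b : |m₂ n| ≤ C_E * divWeight n * B₂ / ℓ ^ s₂ := by
      simp only [hm₂]
      rw [abs_div, abs_mul, abs_of_nonneg hE0, abs_of_pos (pow_pos hℓ0 _)]
      gcongr
      exact abs_eval_le R₂ hu0 hu1
    have hdec : (Nat.totient n : ℝ) * W n ^ 2 * (S₁ M n * S₂ M n) - (Nat.totient n : ℝ) * W n ^ 2 * (m₁ n * m₂ n) =
        (Nat.totient n : ℝ) * W n ^ 2 * (m₁ n * e₂ + e₁ * m₂ n + e₁ * e₂) := by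
      simp only [he₁, he₂]; ring
    rw [hdec, abs_mul, abs_of_nonneg hφW0]
    -- the three products
    have hp1 : |m₁ n * e₂| ≤ (C_E * divWeight n * B₁ / ℓ ^ s₁) * (C₂ * divWeight n * (1 + kappa n) / ℓ ^ (s₂ + 1)) := by
      rw [abs_mul]; exact mul_le_mul hm₁b he₂b (abs_nonneg _) (by positivity)
    have hp2 : |e₁ * m₂ n| ≤ (C₁ * divWeight n * (1 + kappa n) / ℓ ^ (s₁ + 1)) * (C_E * divWeight n * B₂ / ℓ ^ s₂) := by
      rw [abs_mul]; exact mul_le_mul he₁b hm₂b (abs_nonneg _) (by positivity)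
    have hp3 : |e₁ * e₂| ≤ (C₁ * divWeight n * (1 + kappa n) / ℓ ^ (s₁ + 1)) *
        (C₂ * divWeight n * (1 + kappa n) / ℓ ^ (s₂ + 1)) := by
      rw [abs_mul]; exact mul_le_mul he₁b he₂b (abs_nonneg _) (by positivity)
    -- `(1+κ)² ≤ (1+κ)·2ℓ`
    have hκ2 : (1 + kappa n) * (1 + kappa n) ≤ (1 + kappa n) * (2 * ℓ) :=
      mul_le_mul_of_nonneg_left (by linarith) (by positivity)
    have hsum3 : |m₁ n * e₂ + e₁ * m₂ n + e₁ * e₂| ≤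
        (C_E * B₁ * C₂ + C₁ * C_E * B₂ + 2 * C₁ * C₂) * (divWeight n ^ 2 * (1 + kappa n)) / ℓ ^ (s₁ + s₂ + 1) := by
      have hℓpow : ℓ ^ s₁ * ℓ ^ (s₂ + 1) = ℓ ^ (s₁ + s₂ + 1) := by ring
      have hℓpow' : ℓ ^ (s₁ + 1) * ℓ ^ s₂ = ℓ ^ (s₁ + s₂ + 1) := by ring
      have hℓpow'' : ℓ ^ (s₁ + 1) * ℓ ^ (s₂ + 1) = ℓ ^ (s₁ + s₂ + 1) * ℓ := by ring
      calc |m₁ n * e₂ + e₁ * m₂ n + e₁ * e₂| ≤ |m₁ n * e₂| + |e₁ * m₂ n| + |e₁ * e₂| := abs_add_three _ _ _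
        _ ≤ (C_E * divWeight n * B₁ / ℓ ^ s₁) * (C₂ * divWeight n * (1 + kappa n) / ℓ ^ (s₂ + 1)) +
            (C₁ * divWeight n * (1 + kappa n) / ℓ ^ (s₁ + 1)) * (C_E * divWeight n * B₂ / ℓ ^ s₂) +
            (C₁ * divWeight n * (1 + kappa n) / ℓ ^ (s₁ + 1)) * (C₂ * divWeight n * (1 + kappa n) / ℓ ^ (s₂ + 1)) :=
            add_le_add (add_le_add hp1 hp2) hp3
        _ = (C_E * B₁ * C₂ + C₁ * C_E * B₂) * (divWeight n ^ 2 * (1 + kappa n)) / ℓ ^ (s₁ + s₂ + 1) +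
            C₁ * C₂ * divWeight n ^ 2 * ((1 + kappa n) * (1 + kappa n)) / (ℓ ^ (s₁ + s₂ + 1) * ℓ) := by
            rw [div_mul_div_comm, div_mul_div_comm, div_mul_div_comm, hℓpow, hℓpow', hℓpow'']
            field_simp
        _ ≤ (C_E * B₁ * C₂ + C₁ * C_E * B₂) * (divWeight n ^ 2 * (1 + kappa n)) / ℓ ^ (s₁ + s₂ + 1) +
            C₁ * C₂ * divWeight n ^ 2 * ((1 + kappa n) * (2 * ℓ)) / (ℓ ^ (s₁ + s₂ + 1) * ℓ) := by
            gcongr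
        _ = (C_E * B₁ * C₂ + C₁ * C_E * B₂ + 2 * C₁ * C₂) * (divWeight n ^ 2 * (1 + kappa n)) / ℓ ^ (s₁ + s₂ + 1) := by
            field_simp
    exact mul_le_mul hφW hsum3 (abs_nonneg _) (inv_nonneg.2 hn0'.le)
  -- Step 3: sum the errors
  have hsumD : ∑ n ∈ Icc 1 N, divWeight n ^ 2 * (1 + kappa n) / n ≤ 49 * A * 3 * ℓ := by
    have h1 := sum_divWeight_sq_div_le hN1
    have h2 := sum_kappa_divWeight_sq_div_le hN1
    rw [← hA] at h1 h2
    have hsplit : ∑ n ∈ Icc 1 N, divWeight n ^ 2 * (1 + kappa n) / n =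
        ∑ n ∈ Icc 1 N, divWeight n ^ 2 / n + ∑ n ∈ Icc 1 N, kappa n * divWeight n ^ 2 / n := by
      rw [← Finset.sum_add_distrib]
      exact Finset.sum_congr rfl fun n _ ↦ by ring
    rw [hsplit]
    have h3 : 2 + Real.log N ≤ 3 * ℓ := by linarith
    calc ∑ n ∈ Icc 1 N, divWeight n ^ 2 / n + ∑ n ∈ Icc 1 N, kappa n * divWeight n ^ 2 / n
        ≤ A * (2 + Real.log N) + 48 * A * (2 + Real.log N) := add_le_add h1 h2
      _ = 49 * A * (2 + Real.log N) := by ring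
      _ ≤ 49 * A * (3 * ℓ) := mul_le_mul_of_nonneg_left h3 (by positivity)
      _ = 49 * A * 3 * ℓ := by ring
  have herrsum : |∑ n ∈ Icc 1 N, (Nat.totient n : ℝ) * W n ^ 2 * (S₁ M n * S₂ M n) -
      ∑ n ∈ Icc 1 N, (Nat.totient n : ℝ) * W n ^ 2 * (m₁ n * m₂ n)| ≤ K / ℓ ^ (s₁ + s₂) := by
    rw [← Finset.sum_sub_distrib]
    calc _ ≤ ∑ n ∈ Icc 1 N, |(Nat.totient n : ℝ) * W n ^ 2 * (S₁ M n * S₂ M n) -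
            (Nat.totient n : ℝ) * W n ^ 2 * (m₁ n * m₂ n)| := Finset.abs_sum_le_sum_abs _ _
      _ ≤ ∑ n ∈ Icc 1 N, (n : ℝ)⁻¹ * ((C_E * B₁ * C₂ + C₁ * C_E * B₂ + 2 * C₁ * C₂) *
            (divWeight n ^ 2 * (1 + kappa n)) / ℓ ^ (s₁ + s₂ + 1)) := Finset.sum_le_sum herr
      _ = (C_E * B₁ * C₂ + C₁ * C_E * B₂ + 2 * C₁ * C₂) / ℓ ^ (s₁ + s₂ + 1) *
            ∑ n ∈ Icc 1 N, divWeight n ^ 2 * (1 + kappa n) / n := by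
            have hpt : ∀ n : ℕ, (n : ℝ)⁻¹ * ((C_E * B₁ * C₂ + C₁ * C_E * B₂ + 2 * C₁ * C₂) *
                (divWeight n ^ 2 * (1 + kappa n)) / ℓ ^ (s₁ + s₂ + 1)) =
                (C_E * B₁ * C₂ + C₁ * C_E * B₂ + 2 * C₁ * C₂) / ℓ ^ (s₁ + s₂ + 1) *
                  (divWeight n ^ 2 * (1 + kappa n) / n) := fun n ↦ by ring
            rw [Finset.sum_congr rfl fun n _ ↦ hpt n, ← Finset.mul_sum]
      _ ≤ (C_E * B₁ * C₂ + C₁ * C_E * B₂ + 2 * C₁ * C₂) / ℓ ^ (s₁ + s₂ + 1) * (49 * A * 3 * ℓ) :=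
            mul_le_mul_of_nonneg_left hsumD (by positivity)
      _ = K / ℓ ^ (s₁ + s₂) := by
            rw [hK, pow_succ]
            field_simp
  -- Step 4: assembly
  have hfinal : |∑ n ∈ Icc 1 N, (Nat.totient n : ℝ) * W n ^ 2 * (S₁ M n * S₂ M n) -
      (π ^ 2 / 6) ^ 2 * (∫ u in (0 : ℝ)..1, (R₁ * R₂).eval u) * ℓ / ℓ ^ (s₁ + s₂)| ≤
      (π ^ 2 / 6 * C_R + K) / ℓ ^ (s₁ + s₂) := by
    have e : ∑ n ∈ Icc 1 N, (Nat.totient n : ℝ) * W n ^ 2 * (S₁ M n * S₂ M n) -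
        (π ^ 2 / 6) ^ 2 * (∫ u in (0 : ℝ)..1, (R₁ * R₂).eval u) * ℓ / ℓ ^ (s₁ + s₂) =
        (∑ n ∈ Icc 1 N, (Nat.totient n : ℝ) * W n ^ 2 * (S₁ M n * S₂ M n) -
          ∑ n ∈ Icc 1 N, (Nat.totient n : ℝ) * W n ^ 2 * (m₁ n * m₂ n)) +
        (∑ n ∈ Icc 1 N, (Nat.totient n : ℝ) * W n ^ 2 * (m₁ n * m₂ n) -
          (π ^ 2 / 6) ^ 2 * (∫ u in (0 : ℝ)..1, (R₁ * R₂).eval u) * ℓ / ℓ ^ (s₁ + s₂)) := by ring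
    rw [e]
    calc _ ≤ |∑ n ∈ Icc 1 N, (Nat.totient n : ℝ) * W n ^ 2 * (S₁ M n * S₂ M n) -
            ∑ n ∈ Icc 1 N, (Nat.totient n : ℝ) * W n ^ 2 * (m₁ n * m₂ n)| +
          |∑ n ∈ Icc 1 N, (Nat.totient n : ℝ) * W n ^ 2 * (m₁ n * m₂ n) -
            (π ^ 2 / 6) ^ 2 * (∫ u in (0 : ℝ)..1, (R₁ * R₂).eval u) * ℓ / ℓ ^ (s₁ + s₂)| := abs_add_le _ _
      _ ≤ K / ℓ ^ (s₁ + s₂) + π ^ 2 / 6 * C_R / ℓ ^ (s₁ + s₂) := add_le_add herrsum hmain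
      _ = (π ^ 2 / 6 * C_R + K) / ℓ ^ (s₁ + s₂) := by ring
  calc _ ≤ (π ^ 2 / 6 * C_R + K) / ℓ ^ (s₁ + s₂) := hfinal
    _ ≤ (π ^ 2 / 6 * C_R + K + 1) / ℓ ^ (s₁ + s₂) :=
        div_le_div_of_nonneg_right (by linarith) (by positivity)

end Summit.Parity.GeneralizedHardyLittlewood.Theorems.MomentsBeyondDiagonal.DiagKernel

end
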